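import Literature.Analysis.OperatorTheory.RieszProjectionStrongLimit
import Mathlib.Analysis.InnerProductSpace.l2Space
import HarnessLib

/-!
# The Riesz projection of an operator with an orthonormal eigenbasis: action on the basis,
  finite-sum formula, range and rank (Kato III-§6.5 / V-§3.5)

Analysis/OperatorTheory proofs-layer file (theorems only, no definitions, no named facts),
continuing `RieszProjectionContour.lean` (`P v = v` for eigenvectors inside the circle). For a
bounded operator `T` on a complex Hilbert space with a Hilbert basis of eigenvectors
`T eᵢ = κᵢ eᵢ` (compact normal / self-adjoint operators, Kato V-§3.5, V-(3.22):
`T = Σ λ_h P_h`; Reed–Simon I Thm. VII.2: the functional calculus is diagonal in an eigenbasis)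
and a circle `C(c, R)` in the resolvent set, the Riesz projection
`P = (2πi)⁻¹ ∮_{C(c,R)} (z − T)⁻¹ dz` (Kato III-(6.19)) is the orthogonal projection onto the
closed span of the `eᵢ` with `κᵢ` inside the circle (Kato III-§6.5: for an isolated eigenvalue
of a normal operator "`P` is an orthogonal projection", V-§3.5). We prove the consequences that
make the RANK hypotheses of `SimpleEigenvalueHolomorphic.lean` checkable from spectral data:

* `circleIntegral_resolvent_apply_of_apply_eq_smul_of_not_mem`,
  `rieszProjection_apply_of_apply_eq_smul_of_not_mem{_ball}`: **`P v = 0` for an eigenvector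
  whose eigenvalue lies OUTSIDE the disc** (Cauchy's theorem for `(z − μ)⁻¹` on the disc); with
  the tree's `rieszProjection_apply_of_apply_eq_smul` (`P v = v` inside) this gives
  `rieszProjection_apply_hilbertBasis_of_mem` / `_of_not_mem`: `P eᵢ = eᵢ` if `κᵢ ∈ ball c R`,
  `P eᵢ = 0` otherwise;
* `clm_apply_eq_sum_of_apply_hilbertBasis`, `range_eq_span_of_apply_hilbertBasis`,
  `finrank_range_eq_card_of_apply_hilbertBasis`: an operator acting on a Hilbert basis as the
  indicator of a finite index set `J` is `x ↦ Σ_{i ∈ J} ⟨eᵢ, x⟩ eᵢ`, with range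
  `span {eᵢ : i ∈ J}` of dimension `|J|`;
* **`rieszProjection_apply_eq_sum`, `finrank_range_rieszProjection_eq_card`**: if exactly the
  indices `i ∈ I` (finite) have `κᵢ` inside the circle, `P x = Σ_{i∈I} ⟨eᵢ, x⟩ eᵢ` and
  `dim Ran P = |I|` — the total multiplicity inside the circle;
* **`one_sub_rieszProjection_apply_eq_sum`, `finrank_range_one_sub_rieszProjection_eq_card`**:
  dually for the complementary projection `1 − P` and the indices with `κᵢ` outside — e.g.
  `dim Ran (1 − P_r) = 1` iff exactly one simple eigenvalue has modulus `> r`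
  (`finrank_range_one_sub_rieszProjection_eq_one`), the hypothesis of
  `exists_dominant_eigenvalue_asymptotics`.

## Mathlib / tree search

Mathlib: `HilbertBasis.hasSum_repr`, `HilbertBasis.repr_apply_apply`, `ContinuousLinearMap.hasSum`,
`hasSum_sum_of_ne_finset_zero`, `finrank_span_eq_card`,
`circleIntegral_eq_zero_of_differentiable_on_off_countable`; tree: `resolvent_apply_of_apply_eq_smul`,
`rieszProjection_apply_of_apply_eq_smul`, `mem_spectrum_of_apply_eq_smul`, `circleIntegral_clm_apply`,
`EigenbasisSpectralProjection.specProj` (the diagonal spectral projection, not linked to the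
Riesz integral before). Searched `rieszProjection.*HilbertBasis`, `specProj.*riesz` — none.

## References

* T. Kato, *Perturbation Theory for Linear Operators*, Springer 1966, III-§6.4 Thm. 6.17 (6.19),
  III-§6.5, V-§3.5 (3.22). [Kato1966]
-/

noncomputable section

open Complex MeasureTheory Metric Set Filter Topology
open scoped InnerProductSpace

namespace Literature.Analysis.OperatorTheory

/-! ### Eigenvectors with eigenvalue outside the disc are killed by `P` -/

section Operator

variable {E : Type*} [NormedAddCommGroup E] [NormedSpace ℂ E] [CompleteSpace E]

omit [CompleteSpace E] in
/-- `∮_{C(c,R)} (z − μ)⁻¹ dz = 0` for `μ` outside the closed disc (Cauchy). [cite: Kato1966, III-§6.4 Thm. 6.17 (6.19)] -/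
theorem circleIntegral_sub_inv_of_not_mem_closedBall {c μ : ℂ} {R : ℝ} (hR : 0 ≤ R)
    (hμ : μ ∉ closedBall c R) : (∮ z in C(c, R), (z - μ)⁻¹) = 0 := by
  have hne : ∀ z ∈ closedBall c R, z - μ ≠ 0 := fun z hz h => hμ (sub_eq_zero.1 h ▸ hz)
  refine circleIntegral_eq_zero_of_differentiable_on_off_countable hR countable_empty
    (fun z hz => ?_) (fun z hz => ?_)
  · exact ((continuousAt_id.sub continuousAt_const).inv₀ (hne z hz)).continuousWithinAt
  · exact (differentiableAt_id.sub_const μ).inv (hne z (ball_subset_closedBall hz.1))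

/-- **The Riesz integral kills eigenvectors with eigenvalue outside the closed disc**: if
`T v = μ v`, `|μ − c| > R` and the circle lies in `ρ(T)`, then `(∮_{C(c,R)} (z − T)⁻¹ dz) v = 0`
(`(z − T)⁻¹ v = (z − μ)⁻¹ v` on the circle and Cauchy's theorem; Kato III-§6.5: the eigenspaces of
the eigenvalues in `Σ″` lie in `M″ = (1 − P)X`). [cite: Kato1966, III-§6.4 Thm. 6.17 (6.19) and III-§6.5] -/
theorem circleIntegral_resolvent_apply_of_apply_eq_smul_of_not_mem {T : E →L[ℂ] E} {μ : ℂ}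
    {v : E} (hv : T v = μ • v) {c : ℂ} {R : ℝ} (hR : 0 ≤ R) (hμ : μ ∉ closedBall c R)
    (hs : sphere c R ⊆ resolventSet ℂ T) : (∮ z in C(c, R), resolvent T z) v = 0 := by
  have hint : CircleIntegrable (resolvent T) c R :=
    ((continuousOn_resolvent T).mono hs).circleIntegrable hR
  rw [circleIntegral_clm_apply hint v,
    circleIntegral.integral_congr hR fun z hz => resolvent_apply_of_apply_eq_smul hv (hs hz),
    circleIntegral.integral_smul_const, circleIntegral_sub_inv_of_not_mem_closedBall hR hμ,
    zero_smul]

/-- **`P v = 0` for eigenvectors with eigenvalue outside the closed disc.**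
[cite: Kato1966, III-§6.4 Thm. 6.17 (6.19) and III-§6.5] -/
theorem rieszProjection_apply_of_apply_eq_smul_of_not_mem {T : E →L[ℂ] E} {μ : ℂ} {v : E}
    (hv : T v = μ • v) {c : ℂ} {R : ℝ} (hR : 0 ≤ R) (hμ : μ ∉ closedBall c R)
    (hs : sphere c R ⊆ resolventSet ℂ T) : rieszProjection T c R v = 0 := by
  rw [rieszProjection_def, smul_apply,
    circleIntegral_resolvent_apply_of_apply_eq_smul_of_not_mem hv hR hμ hs, smul_zero]

/-- For an eigenvector `v ≠ 0` the dichotomy is by the OPEN disc: if `μ ∉ ball c R` then, the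
circle being in the resolvent set, `μ ∉ closedBall c R` and `P v = 0`. [cite: Kato1966, III-§6.4 Thm. 6.17 (6.19) and III-§6.5] -/
theorem rieszProjection_apply_of_apply_eq_smul_of_not_mem_ball {T : E →L[ℂ] E} {μ : ℂ} {v : E}
    (hv : T v = μ • v) (hv0 : v ≠ 0) {c : ℂ} {R : ℝ} (hR : 0 ≤ R) (hμ : μ ∉ ball c R)
    (hs : sphere c R ⊆ resolventSet ℂ T) : rieszProjection T c R v = 0 := by
  refine rieszProjection_apply_of_apply_eq_smul_of_not_mem hv hR (fun hμ' => ?_) hs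
  rcases (mem_closedBall.1 hμ').lt_or_eq with hlt | heq
  · exact hμ (mem_ball.2 hlt)
  · exact spectrum.mem_iff.1 (mem_spectrum_of_apply_eq_smul hv hv0)
      (spectrum.mem_resolventSet_iff.1 (hs (mem_sphere.2 heq)))

end Operator

/-! ### Operators acting as an indicator on a Hilbert basis -/

section Hilbert

variable {H : Type*} [NormedAddCommGroup H] [InnerProductSpace ℂ H] [CompleteSpace H]
variable {ι : Type*} (e : HilbertBasis ι ℂ H)

omit [CompleteSpace H] in
/-- **An operator which is the indicator of a finite index set on a Hilbert basis is the finite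
sum `x ↦ Σ_{i∈J} ⟨eᵢ, x⟩ eᵢ`** (expand `x = Σ ⟨eᵢ,x⟩ eᵢ` and apply the bounded operator termwise;
Kato V-(3.22)). [cite: Kato1966, V-§3.5 (3.22)] -/
theorem clm_apply_eq_sum_of_apply_hilbertBasis (Q : H →L[ℂ] H) (J : Finset ι)
    (hQ1 : ∀ i ∈ J, Q (e i) = e i) (hQ0 : ∀ i, i ∉ J → Q (e i) = 0) (x : H) :
    Q x = ∑ i ∈ J, ⟪e i, x⟫_ℂ • e i := by
  have h1 : HasSum (fun i => Q (e.repr x i • e i)) (Q x) := Q.hasSum (e.hasSum_repr x)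
  have h3 : HasSum (fun i => Q (e.repr x i • e i)) (∑ i ∈ J, Q (e.repr x i • e i)) :=
    hasSum_sum_of_ne_finset_zero fun i hi => by rw [map_smul, hQ0 i hi, smul_zero]
  rw [h1.unique h3]
  refine Finset.sum_congr rfl fun i hi => ?_
  rw [map_smul, hQ1 i hi, HilbertBasis.repr_apply_apply]

omit [CompleteSpace H] in
/-- The range of such an operator is the span of the `eᵢ`, `i ∈ J`. [cite: Kato1966, V-§3.5 (3.22)] -/
theorem range_eq_span_of_apply_hilbertBasis (Q : H →L[ℂ] H) (J : Finset ι)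
    (hQ1 : ∀ i ∈ J, Q (e i) = e i) (hQ0 : ∀ i, i ∉ J → Q (e i) = 0) :
    LinearMap.range (Q : H →ₗ[ℂ] H) = Submodule.span ℂ (Set.range fun i : J => (e i : H)) := by
  apply le_antisymm
  · rintro y ⟨x, rfl⟩
    rw [ContinuousLinearMap.coe_coe, clm_apply_eq_sum_of_apply_hilbertBasis e Q J hQ1 hQ0 x]
    refine Submodule.sum_mem _ fun i hi => Submodule.smul_mem _ _ (Submodule.subset_span ?_)
    exact ⟨⟨i, hi⟩, rfl⟩
  · rw [Submodule.span_le]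
    rintro y ⟨⟨i, hi⟩, rfl⟩
    refine ⟨e i, ?_⟩
    rw [ContinuousLinearMap.coe_coe, hQ1 i hi]

omit [CompleteSpace H] in
/-- Its rank is `|J|` (the `eᵢ` are linearly independent). [cite: Kato1966, V-§3.5 (3.22)] -/
theorem finrank_range_eq_card_of_apply_hilbertBasis (Q : H →L[ℂ] H) (J : Finset ι)
    (hQ1 : ∀ i ∈ J, Q (e i) = e i) (hQ0 : ∀ i, i ∉ J → Q (e i) = 0) :
    Module.finrank ℂ (LinearMap.range (Q : H →ₗ[ℂ] H)) = J.card := by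
  rw [range_eq_span_of_apply_hilbertBasis e Q J hQ1 hQ0]
  have hli : LinearIndependent ℂ fun i : J => (e i : H) :=
    e.orthonormal.linearIndependent.comp (fun i : J => (i : ι)) Subtype.val_injective
  rw [finrank_span_eq_card hli, Fintype.card_coe]

/-! ### The Riesz projection in an eigenbasis -/

variable {e} {T : H →L[ℂ] H} {κ : ι → ℂ}

/-- **`P eᵢ = eᵢ` when `κᵢ` is inside the circle** (eigenbasis `T eᵢ = κᵢ eᵢ`, circle in
`ρ(T)`). [cite: Kato1966, III-§6.4 Thm. 6.17 (6.19) and III-§6.5] -/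
theorem rieszProjection_apply_hilbertBasis_of_mem (hT : ∀ i, T (e i) = κ i • e i) {c : ℂ}
    {R : ℝ} (hs : sphere c R ⊆ resolventSet ℂ T) {i : ι} (hi : κ i ∈ ball c R) :
    rieszProjection T c R (e i) = e i :=
  rieszProjection_apply_of_apply_eq_smul (hT i) hi hs

/-- **`P eᵢ = 0` when `κᵢ` is not inside the circle** (Kato III-§6.5 / V-§3.5: the Riesz
projection of a normal operator is the orthogonal projection onto the eigenspaces inside).
[cite: Kato1966, III-§6.4 Thm. 6.17 (6.19) and III-§6.5] -/
theorem rieszProjection_apply_hilbertBasis_of_not_mem (hT : ∀ i, T (e i) = κ i • e i) {c : ℂ}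
    {R : ℝ} (hR : 0 ≤ R) (hs : sphere c R ⊆ resolventSet ℂ T) {i : ι} (hi : κ i ∉ ball c R) :
    rieszProjection T c R (e i) = 0 :=
  rieszProjection_apply_of_apply_eq_smul_of_not_mem_ball (hT i) (e.orthonormal.ne_zero i) hR hi hs

/-- **`P x = Σ_{i∈I} ⟨eᵢ, x⟩ eᵢ`** when exactly the indices in the finite set `I` have their
eigenvalue inside the circle: the Riesz projection is the orthogonal projection onto
`span {eᵢ : i ∈ I}`. [cite: Kato1966, III-§6.5 and V-§3.5 (3.22)] -/
theorem rieszProjection_apply_eq_sum (hT : ∀ i, T (e i) = κ i • e i) {c : ℂ} {R : ℝ}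
    (hR : 0 ≤ R) (hs : sphere c R ⊆ resolventSet ℂ T) (I : Finset ι)
    (hI : ∀ i, κ i ∈ ball c R ↔ i ∈ I) (x : H) :
    rieszProjection T c R x = ∑ i ∈ I, ⟪e i, x⟫_ℂ • e i :=
  clm_apply_eq_sum_of_apply_hilbertBasis e _ I
    (fun i hi => rieszProjection_apply_hilbertBasis_of_mem hT hs ((hI i).2 hi))
    (fun i hi => rieszProjection_apply_hilbertBasis_of_not_mem hT hR hs fun h => hi ((hI i).1 h)) x

/-- **The total multiplicity inside the circle**: `dim Ran P = |I|`. [cite: Kato1966, III-§6.5 and V-§3.5 (3.22)] -/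
theorem finrank_range_rieszProjection_eq_card (hT : ∀ i, T (e i) = κ i • e i) {c : ℂ} {R : ℝ}
    (hR : 0 ≤ R) (hs : sphere c R ⊆ resolventSet ℂ T) (I : Finset ι)
    (hI : ∀ i, κ i ∈ ball c R ↔ i ∈ I) :
    Module.finrank ℂ (LinearMap.range ((rieszProjection T c R : H →L[ℂ] H) : H →ₗ[ℂ] H)) =
      I.card :=
  finrank_range_eq_card_of_apply_hilbertBasis e _ I
    (fun i hi => rieszProjection_apply_hilbertBasis_of_mem hT hs ((hI i).2 hi))
    (fun i hi => rieszProjection_apply_hilbertBasis_of_not_mem hT hR hs fun h => hi ((hI i).1 h))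

/-- `(1 − P) eᵢ = 0` inside, `= eᵢ` outside. [cite: Kato1966, III-§6.4 Thm. 6.17 (6.19) and III-§6.5] -/
theorem one_sub_rieszProjection_apply_hilbertBasis_of_mem (hT : ∀ i, T (e i) = κ i • e i)
    {c : ℂ} {R : ℝ} (hs : sphere c R ⊆ resolventSet ℂ T) {i : ι} (hi : κ i ∈ ball c R) :
    (1 - rieszProjection T c R) (e i) = 0 := by
  rw [sub_apply, one_apply_eq_self, rieszProjection_apply_hilbertBasis_of_mem hT hs hi, sub_self]

/-- `(1 − P) eᵢ = eᵢ` when `κᵢ` is not inside the circle. [cite: Kato1966, III-§6.4 Thm. 6.17 (6.19) and III-§6.5] -/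
theorem one_sub_rieszProjection_apply_hilbertBasis_of_not_mem (hT : ∀ i, T (e i) = κ i • e i)
    {c : ℂ} {R : ℝ} (hR : 0 ≤ R) (hs : sphere c R ⊆ resolventSet ℂ T) {i : ι}
    (hi : κ i ∉ ball c R) : (1 - rieszProjection T c R) (e i) = e i := by
  rw [sub_apply, one_apply_eq_self, rieszProjection_apply_hilbertBasis_of_not_mem hT hR hs hi,
    sub_zero]

/-- **`(1 − P) x = Σ_{i∈J} ⟨eᵢ, x⟩ eᵢ`** when exactly the indices in the finite set `J` have their
eigenvalue not inside the circle (the complementary spectral projection `1 − P` onto `M″`).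
[cite: Kato1966, III-§6.4 Thm. 6.17 (6.19) and III-§6.5] -/
theorem one_sub_rieszProjection_apply_eq_sum (hT : ∀ i, T (e i) = κ i • e i) {c : ℂ} {R : ℝ}
    (hR : 0 ≤ R) (hs : sphere c R ⊆ resolventSet ℂ T) (J : Finset ι)
    (hJ : ∀ i, κ i ∉ ball c R ↔ i ∈ J) (x : H) :
    (1 - rieszProjection T c R) x = ∑ i ∈ J, ⟪e i, x⟫_ℂ • e i :=
  clm_apply_eq_sum_of_apply_hilbertBasis e _ J
    (fun i hi => one_sub_rieszProjection_apply_hilbertBasis_of_not_mem hT hR hs ((hJ i).2 hi))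
    (fun i hi => one_sub_rieszProjection_apply_hilbertBasis_of_mem hT hs
      (not_not.1 fun h => hi ((hJ i).1 h))) x

/-- **The total multiplicity outside the circle**: `dim Ran (1 − P) = |J|`.
[cite: Kato1966, III-§6.4 Thm. 6.17 (6.19) and III-§6.5] -/
theorem finrank_range_one_sub_rieszProjection_eq_card (hT : ∀ i, T (e i) = κ i • e i) {c : ℂ}
    {R : ℝ} (hR : 0 ≤ R) (hs : sphere c R ⊆ resolventSet ℂ T) (J : Finset ι)
    (hJ : ∀ i, κ i ∉ ball c R ↔ i ∈ J) :
    Module.finrank ℂ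
      (LinearMap.range ((1 - rieszProjection T c R : H →L[ℂ] H) : H →ₗ[ℂ] H)) = J.card :=
  finrank_range_eq_card_of_apply_hilbertBasis e _ J
    (fun i hi => one_sub_rieszProjection_apply_hilbertBasis_of_not_mem hT hR hs ((hJ i).2 hi))
    (fun i hi => one_sub_rieszProjection_apply_hilbertBasis_of_mem hT hs
      (not_not.1 fun h => hi ((hJ i).1 h)))

/-- The simple-eigenvalue case: if `i₀` is the only index with `κᵢ` inside the circle then
`dim Ran P = 1`. [cite: Kato1966, III-§6.5] -/
theorem finrank_range_rieszProjection_eq_one (hT : ∀ i, T (e i) = κ i • e i) {c : ℂ} {R : ℝ}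
    (hR : 0 ≤ R) (hs : sphere c R ⊆ resolventSet ℂ T) (i₀ : ι)
    (hI : ∀ i, κ i ∈ ball c R ↔ i = i₀) :
    Module.finrank ℂ (LinearMap.range ((rieszProjection T c R : H →L[ℂ] H) : H →ₗ[ℂ] H)) = 1 := by
  rw [finrank_range_rieszProjection_eq_card hT hR hs {i₀}
      (fun i => by rw [Finset.mem_singleton]; exact hI i), Finset.card_singleton]

/-- Dually: if `i₀` is the only index with `κᵢ` not inside the circle then `dim Ran (1 − P) = 1`
— exactly one simple eigenvalue of modulus `> r` for the circle `|z| = r`, the hypothesis of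
`exists_dominant_eigenvalue_asymptotics`. [cite: Kato1966, III-§6.5] -/
theorem finrank_range_one_sub_rieszProjection_eq_one (hT : ∀ i, T (e i) = κ i • e i) {c : ℂ}
    {R : ℝ} (hR : 0 ≤ R) (hs : sphere c R ⊆ resolventSet ℂ T) (i₀ : ι)
    (hJ : ∀ i, κ i ∉ ball c R ↔ i = i₀) :
    Module.finrank ℂ
      (LinearMap.range ((1 - rieszProjection T c R : H →L[ℂ] H) : H →ₗ[ℂ] H)) = 1 := by
  rw [finrank_range_one_sub_rieszProjection_eq_card hT hR hs {i₀}
      (fun i => by rw [Finset.mem_singleton]; exact hJ i), Finset.card_singleton]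

end Hilbert

end Literature.Analysis.OperatorTheory
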